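import Mathlib
import HarnessLib
import Summits.HubbardSuperconductivity.HubbardSuperconductivity.Theorems.KLProgrammeKLRegimeSplitSlotsV17F2

/-!
# Route `KLProgramme` — ENGINE item stmt-HubbardSuperconductivity-20437 `KLRegimeEngineV17F2`: the DEGENERATE RENORMALISATION CLASS `R.Gfr 0 = 0`
# (pen (R422)(B)(2) / (R423)(D) «DEGENERATE-CLASS AUDIT» of the located item «(C)-HRES-GFR0-VACUITY»; cell gate-hubbard-kl, seat p2 g27)

WHAT.  `RenConsts.WF2 := WF ∧ 0 < cr ∧ 0 < cz` admits `R.Gfr 0 = 0`, and the crux quantifies `∀ R, R.WF2 →`.  On that class the history hypothesis of every registered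
row is RIGID: the scale-`m` renormalisation slot `klPredsV17F2.renorm … R m = RenormFlowAtV17F … R m` contains `FlowPieceJetsAt L M β U μ R m`, whose order-`0` clause reads
`‖evalM (klFlowPiece … m) q‖ ≤ R.Gfr 0 · |U| · 4^{−2m}`; with `R.Gfr 0 = 0` it forces the DEFINED flow piece `klFlowPiece L M β U μ m` to vanish identically.  Hence:
* `evalM_klFlowPiece_eq_zero_of_gfr_zero` — `FlowPieceJetsAt … R m → R.Gfr 0 = 0 → evalM (klFlowPiece … m) = 0`;
* `gfr_zero_pos_of_flowPieceJetsAt` — contrapositive: ONE point where the scale-`m` piece is nonzero and `0 ≤ R.Gfr 0` give `0 < R.Gfr 0`;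
* **`gfr_zero_pos_of_histP`** — the GUARDED row of the (C) closer's package `hres′` (…EngineV17F2ClosersCGQGuard: `1 ≤ n → 0 < R.Gfr 0` under
  `HistP klPredsV17F2 L M G P Q R β U μ 0 n`) follows from `R.WF` and the single R-FREE scale-0 model fact
  **«TADPOLE-NONVANISHING»** `∃ q, evalM (klFlowPiece L M β U μ 0) q ≠ 0` (the Jackson frame of the scale-0 reading — the UV tadpole — is not the zero function).
So on the degenerate class the registered rows at `1 ≤ n` are VACUOUS given «TADPOLE-NONVANISHING», and at `n = 0` the (C) closer uses no `Gfr` at all: the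
(γ′) «GUARD-AND-SPLIT» cure needs no Gfr₀-free driver re-thread, only that one named fact (owner: the scale-0 lane; NOT proved here).
Pure unfolding of landed definitions; nothing here asserts «TADPOLE-NONVANISHING», any row of 20437, K3, the Kohn–Luttinger margin or superconductivity.  0 kit · 0 lit.
References: BGM 2006 §3 (3.2)–(3.3) (the counterterm pieces of the flow) [cite: BenfattoGiulianiMastropietro2006].
-/

noncomputable section

namespace Summit.HubbardSuperconductivity.HubbardSuperconductivity.Theorems.EngineV8

set_option linter.dupNamespace false -- summit = problem name (single-conjunct summit), D-0017

open Real Finset Literature.MathematicalPhysics.QuantumLattice Literature.Probability.LatticeModels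
open Summit.HubbardSuperconductivity.HubbardSuperconductivity.Theorems.KLRegimeSplit
open Summit.HubbardSuperconductivity.HubbardSuperconductivity.Theorems.KLProgrammeLegKernels
open Summit.HubbardSuperconductivity.HubbardSuperconductivity.Theorems.DispersionFlow

section Model

variable {L M : ℕ} [NeZero L] [NeZero M] {G : GeoConsts} {P : SplitConsts} {Q : EngConsts} {R : RenConsts} {β U μ : ℝ} {m n : ℕ}

/-- **On `R.Gfr 0 = 0` every scale-`m` flow piece vanishes identically** (order-`0` clause of `FlowPieceJetsAt`). [cite: BenfattoGiulianiMastropietro2006, §3 (3.2)] -/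
theorem evalM_klFlowPiece_eq_zero_of_gfr_zero (h : FlowPieceJetsAt L M β U μ R m) (h0 : R.Gfr 0 = 0) :
    evalM (klFlowPiece L M β U μ m) = 0 := by
  funext q
  have h' := h 0 (by norm_num) q
  rw [norm_iteratedFDeriv_zero, h0, zero_mul, zero_mul] at h'
  exact norm_le_zero_iff.1 h'

/-- **Contrapositive**: one point where the scale-`m` flow piece is nonzero forces `0 < R.Gfr 0` (given `0 ≤ R.Gfr 0`). [cite: BenfattoGiulianiMastropietro2006, §3 (3.2)] -/
theorem gfr_zero_pos_of_flowPieceJetsAt (h : FlowPieceJetsAt L M β U μ R m) (hR0 : 0 ≤ R.Gfr 0) {q : Momentum}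
    (hq : evalM (klFlowPiece L M β U μ m) q ≠ 0) : 0 < R.Gfr 0 := by
  rcases hR0.lt_or_eq with h0 | h0
  · exact h0
  · exact absurd (congrFun (evalM_klFlowPiece_eq_zero_of_gfr_zero h h0.symm) q) hq

/-- **THE GUARDED ROW OF `hres′` FROM «TADPOLE-NONVANISHING»**: under the (C) row's history `HistP klPredsV17F2 … R … 0 n` with `1 ≤ n`, the scale-`0` renormalisation
slot supplies `FlowPieceJetsAt … R 0`; if the scale-0 flow piece is nonzero at one point then `0 < R.Gfr 0`. [cite: BenfattoGiulianiMastropietro2006, §3 (3.2)–(3.3)] -/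
theorem gfr_zero_pos_of_histP (hR : R.WF) (hhist : HistP klPredsV17F2 L M G P Q R β U μ 0 n) (hn : 1 ≤ n)
    (htad : ∃ q : Momentum, evalM (klFlowPiece L M β U μ 0) q ≠ 0) : 0 < R.Gfr 0 := by
  obtain ⟨q, hq⟩ := htad
  have h0 := (hhist 0 (by omega)).2.1
  exact gfr_zero_pos_of_flowPieceJetsAt h0.2.1 (hR.2.2 0) hq

/-- The same in the exact binder shape of `hres′` (…EngineV17F2ClosersCGQGuard): `R.WF2`, history, then the guarded conjunct `1 ≤ n → 0 < R.Gfr 0`.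
[cite: BenfattoGiulianiMastropietro2006, §3 (3.2)–(3.3)] -/
theorem hresGuard_gfr_row_of_tadpole (hR : R.WF2) (hhist : HistP klPredsV17F2 L M G P Q R β U μ 0 n)
    (htad : ∃ q : Momentum, evalM (klFlowPiece L M β U μ 0) q ≠ 0) : 1 ≤ n → 0 < R.Gfr 0 :=
  fun hn => gfr_zero_pos_of_histP hR.1 hhist hn htad

end Model

end Summit.HubbardSuperconductivity.HubbardSuperconductivity.Theorems.EngineV8

end
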